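import Summits.RiemannHypothesis.RiemannHypothesis.Theses.WeilComb
import Literature.NumberTheory.LFunctions.WeilExplicitProofs
import Literature.NumberTheory.LFunctions.WeilCriterionProofs
import Literature.NumberTheory.LFunctions.UniformWeilPositivityRH
import Literature.NumberTheory.LFunctions.WeilSmallSupportPositivity
import Literature.NumberTheory.LFunctions.WeilGroundEnergyProofs
import Literature.NumberTheory.LFunctions.WeilMellinBounds

/-!
# Disproof of `CombShapePositivity` (stmt-RiemannHypothesis-11229, route `WeilComb`) — findings

Crux (rank 2): for every `ε > 0`, `M : ℕ`, `a : ℕ → ℂ`, the fixed-shape log-integer comb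
`g(x) = Σ_{m ≤ M} a_m ε⁻¹ φ₀((x − log m)/ε)`, `φ₀(u) = exp(−1/(1−u²)) 1_{|u|<1} = expNegInvGlue (1 − u²)`,
has `0 ≤ Re W(g ⋆ g̃)` (`weilQuadratic`, tree normalisation of `WeilExplicit.lean`).

Standing adversary: refuter-cdisprove-stmt-RiemannHypothesis-11229-0 (from 2026-08-16). Index:

* (R) RESISTANCE, UNCONDITIONAL (§2). `crux_of_riemannHypothesis : RiemannHypothesis → CombShapePositivity`
  (every comb is a Weil test, `comb_isWeilTest`; then `WeilPositivity.of_riemannHypothesis explicit_formula_holds`,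
  both PROVED in the tree). Hence `not_riemannHypothesis_of_not_crux`: a disproof of the crux is a disproof of RH;
  no `refuted-…` outcome exists short of `¬ RiemannHypothesis` in Lean. Also `crux_of_combThesis` (target ⇒ crux:
  the crux is not stronger than X) and `crux_iff_riemannHypothesis_of_detection` (given the support item
  `CombShapeDetection`, crux ↔ RH ↔ X): the crux is RH in comb coordinates, as the planner says.
* (L) LOAD-BEARING ANALYSIS (§3). The only hypothesis is `0 < ε`; it is IDLE: `withoutPos_iff`
  (`ε = 0` gives the zero comb by Lean's `0⁻¹ = 0`, `ε < 0` is the `ε > 0` instance with `a ↦ −a`,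
  `comb_neg_eps`). So the usual `_false_without_` theorem is unavailable in both directions; there is no
  side condition whose removal falsifies the statement.
* (F) FAITHFULNESS / DEGENERATE CORNERS (§4). `comb_M_zero`, `comb_coeff_zero` (zero comb, `Q(0) = 0`: the
  instances `M = 0`, `a = 0` are TRUE, not refuting); `comb_tsupport_subset` (supp ⊆ [−|ε|, log M + |ε|]);
  UNCONDITIONAL RUNGS: `crux_inst_short` — every comb whose active nodes `N ≤ m ≤ N'` satisfy
  `log N' − log N + 2ε ≤ log 2` is settled by Yoshida's theorem (`weilPositivityOn_of_le_log_two_half`) and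
  translation invariance (`weilQuadratic_translate`); in particular `crux_inst_M_one` (M = 1, ε ≤ (log 2)/2) and
  all clusters of ratio < 2: counterexample search is pointless there, the content sits in SPREAD combs (ratios ≥ 2,
  i.e. where prime powers enter the matrix).
* (M) MONOTONICITY (§5). `crux_level_mono`: the level-`M'` instance implies the level-`M` instance for `M ≤ M'`
  (extend `a` by zero), so the crux is equivalent to its restriction to any cofinal set of levels.
* (S) NATURAL STRENGTHENINGS (§6). `not_crux_strict`: the strict inequality fails (tight at `a = 0`); numerically
  (N) the margin `λ_min(K_{ε,M})/‖φ_ε‖₂²` is a function of `ε·M` alone decaying from 1.65 (εM = 0.05) to ~1e-5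
  (εM = 5): no argument with `O(1)·‖φ_ε‖²‖a‖²` losses can prove the transition regime; termwise sufficient
  conditions (Gershgorin / dropping the polar term / keeping only the archimedean diagonal) fail beyond explicit
  εM thresholds — all quantified in §7 (N1)–(N5).
* (N) NUMERICS (§7, docstring `numerics`): exact Gram matrices `K_{ε,M} = [w_ε(log(m/m'))]`, tree normalisation,
  validated against the explicit formula; all PSD; see the table.
* (B) BARRIERS / LITERATURE (§8, docstring `barriers`).

Nothing in this file is sorried. LANDED (negative lane, p73733, commit 46e5492bf84e, importable):
`Summits/RiemannHypothesis/RiemannHypothesis/Theorems/CombShapePositivity/Negative/WeilCombCombShapePositivityLoadBearing.lean`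
with `weilComb_shapeComb_isWeilTest`, `weilComb_not_riemannHypothesis_of_not_combShapePositivity`,
`weilComb_combShapePositivity_iff_riemannHypothesis_of_detection`, `weilComb_combShapePositivity_withoutPos_iff`,
`weilComb_shapeComb_nonneg_of_short`, `weilComb_shapeComb_nonneg_of_weilPositivityOn`,
`weilComb_combShapePositivity_iff_eventually`, `weilComb_not_combShapePositivity_strict` (inline comb, no defs) — the
§2–§6 content below under tree names. Everything positive here (R, F) is otherwise evidence for the provers of the
support items `CombShapeAdmissible` (stmt-11231), `CombConverse` (stmt-1028), `CombShapeDetection` (stmt-11230).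
-/

noncomputable section

set_option linter.dupNamespace false

open Complex Set MeasureTheory Filter
open scoped Real Topology ContDiff

namespace Summit.RiemannHypothesis.RiemannHypothesis.Cruxes.CombShapePositivity.Disproof

open Literature.NumberTheory.LFunctions
open Summit.RiemannHypothesis.RiemannHypothesis.Theses.WeilComb

/-! ## §1 The objects -/

/-- The fixed-shape comb of the crux, verbatim: `x ↦ Σ_{m ∈ [1, M]} a m · (ε⁻¹ · φ₀((x − log m)/ε))`. -/
def comb (ε : ℝ) (M : ℕ) (a : ℕ → ℂ) : ℝ → ℂ :=
  fun x : ℝ => ∑ m ∈ Finset.Icc 1 M,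
    a m * ((ε : ℂ)⁻¹ * ((expNegInvGlue (1 - ((x - Real.log (m : ℝ)) / ε) ^ 2) : ℝ) : ℂ))

/-- One `(ε, M)` cell of the crux: the `M × M` matrix `[w_ε(log(m/m'))]` is positive semidefinite. -/
def CruxAt (ε : ℝ) (M : ℕ) : Prop :=
  ∀ a : ℕ → ℂ, 0 ≤ (weilQuadratic (comb ε M a)).re

/-- The crux is literally `∀ ε > 0, ∀ M, CruxAt ε M`. -/
theorem crux_iff : CombShapePositivity ↔ ∀ ε : ℝ, 0 < ε → ∀ M : ℕ, CruxAt ε M := Iff.rfl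

/-! ## §4a Support and smoothness of combs (faithfulness: no junk inside `weilQuadratic`) -/

/-- Outside `[log m − |ε|, log m + |ε|]` the `m`-th bump vanishes (for `ε ≠ 0`). -/
theorem bump_eq_zero {ε x c : ℝ} (hε : ε ≠ 0) (hx : |ε| ≤ |x - c|) :
    expNegInvGlue (1 - ((x - c) / ε) ^ 2) = 0 := by
  apply expNegInvGlue.zero_of_nonpos
  have h1 : 1 ≤ ((x - c) / ε) ^ 2 := by
    rw [div_pow, le_div_iff₀ (by positivity), one_mul, ← sq_abs, ← sq_abs (x - c)]
    exact pow_le_pow_left₀ (abs_nonneg _) hx 2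
  linarith

/-- Every summand of the comb vanishes off `[−|ε|, log M + |ε|]`. -/
theorem comb_apply_eq_zero {ε : ℝ} {M : ℕ} (a : ℕ → ℂ) {x : ℝ}
    (hx : x ∉ Icc (-|ε|) (Real.log M + |ε|)) : comb ε M a x = 0 := by
  unfold comb
  refine Finset.sum_eq_zero fun m hm => ?_
  rcases eq_or_ne ε 0 with rfl | hε
  · simp
  rw [Finset.mem_Icc] at hm
  have hm1 : (1 : ℝ) ≤ m := by exact_mod_cast hm.1
  have hmM : (m : ℝ) ≤ M := by exact_mod_cast hm.2
  have hlog0 : 0 ≤ Real.log m := Real.log_nonneg hm1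
  have hlogM : Real.log m ≤ Real.log M := Real.log_le_log (by linarith) hmM
  have hfar : |ε| ≤ |x - Real.log m| := by
    simp only [mem_Icc, not_and_or, not_le] at hx
    rcases hx with h | h
    · calc |ε| ≤ Real.log m - x := by linarith [abs_nonneg ε]
        _ ≤ |x - Real.log m| := by rw [abs_sub_comm]; exact le_abs_self _
    · calc |ε| ≤ x - Real.log m := by linarith
        _ ≤ |x - Real.log m| := le_abs_self _
  rw [bump_eq_zero hε hfar]
  simp

/-- `supp(comb) ⊆ [−|ε|, log M + |ε|]`. -/
theorem comb_tsupport_subset (ε : ℝ) (M : ℕ) (a : ℕ → ℂ) :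
    tsupport (comb ε M a) ⊆ Icc (-|ε|) (Real.log M + |ε|) :=
  closure_minimal (fun _ hx => by_contra fun h => hx (comb_apply_eq_zero a h)) isClosed_Icc

/-- Combs have compact support. -/
theorem comb_hasCompactSupport (ε : ℝ) (M : ℕ) (a : ℕ → ℂ) : HasCompactSupport (comb ε M a) :=
  HasCompactSupport.intro isCompact_Icc fun _ hx => comb_apply_eq_zero a hx

/-- Combs are smooth. -/
theorem comb_contDiff (ε : ℝ) (M : ℕ) (a : ℕ → ℂ) : ContDiff ℝ ∞ (comb ε M a) := by
  unfold comb
  refine ContDiff.sum fun m _ => contDiff_const.mul (contDiff_const.mul ?_)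
  have h1 : ContDiff ℝ ∞ fun x : ℝ => expNegInvGlue (1 - ((x - Real.log (m : ℝ)) / ε) ^ 2) :=
    expNegInvGlue.contDiff.comp
      (contDiff_const.sub (((contDiff_id.sub contDiff_const).div_const ε).pow 2))
  exact ofRealCLM.contDiff.comp h1

/-- FAITHFULNESS: every comb (any `ε`, `M`, `a`) is a Weil test, so `weilQuadratic (comb ε M a)` is the
genuine value `W(g ⋆ g̃)` (finite prime sum, convergent Mellin and archimedean integrals), never junk. -/
theorem comb_isWeilTest (ε : ℝ) (M : ℕ) (a : ℕ → ℂ) : IsWeilTest (comb ε M a) :=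
  ⟨comb_contDiff ε M a, comb_hasCompactSupport ε M a⟩

/-! ## §2 Resistance: the crux is RH-implied (so `¬ crux` would be `¬ RH`) -/

/-- **(R1)** `RH → CombShapePositivity`: each comb is a Weil test and Weil positivity follows from RH by the
explicit formula (`WeilPositivity.of_riemannHypothesis explicit_formula_holds`, proved in the tree). -/
theorem crux_of_riemannHypothesis (hRH : RiemannHypothesis) : CombShapePositivity :=
  fun ε _ M a => WeilPositivity.of_riemannHypothesis explicit_formula_holds hRH _ (comb_isWeilTest ε M a)

/-- **(R1')** Any disproof of the crux is a disproof of the Riemann hypothesis. -/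
theorem not_riemannHypothesis_of_not_crux (h : ¬ CombShapePositivity) : ¬ RiemannHypothesis :=
  fun hRH => h (crux_of_riemannHypothesis hRH)

/-- Summit form of (R1'). -/
theorem not_summit_of_not_crux (h : ¬ CombShapePositivity) : ¬ Summit.RiemannHypothesis :=
  not_riemannHypothesis_of_not_crux h

/-- **(R2)** target ⇒ crux: the crux is an instance of uniform Weil positivity (`a = log M + |ε| + 1`). -/
theorem crux_of_combThesis (hX : CombThesis) : CombShapePositivity := by
  intro ε _ M a
  have hA : 0 < Real.log M + |ε| + 1 := by
    have := Real.log_natCast_nonneg M; positivity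
  refine hX _ hA _ (comb_isWeilTest ε M a) ((comb_tsupport_subset ε M a).trans (Icc_subset_Icc ?_ ?_))
  · have := Real.log_natCast_nonneg M; linarith
  · linarith

/-- **(R3)** Given the support item `CombShapeDetection`, the crux is equivalent to RH. -/
theorem crux_iff_riemannHypothesis_of_detection (hDet : CombShapeDetection) :
    CombShapePositivity ↔ RiemannHypothesis :=
  ⟨fun h => riemannHypothesis_iff_forall_weilPositivityOn.mpr (hDet h), crux_of_riemannHypothesis⟩

/-- **(R3')** … and to the route target X. -/
theorem crux_iff_combThesis_of_detection (hDet : CombShapeDetection) :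
    CombShapePositivity ↔ CombThesis :=
  ⟨fun h => hDet h, crux_of_combThesis⟩

/-! ## §3 Load-bearing analysis of the single hypothesis `0 < ε` -/

/-- The crux with the guard `0 < ε` dropped. -/
def CombShapePositivityWithoutPos : Prop :=
  ∀ (ε : ℝ) (M : ℕ), CruxAt ε M

/-- `ε = 0`: Lean's `(0 : ℂ)⁻¹ = 0` makes the comb the zero function. -/
theorem comb_eps_zero (M : ℕ) (a : ℕ → ℂ) : comb 0 M a = 0 := by
  funext x; simp [comb]

/-- `ε ↦ −ε`: `comb (−ε) M a = comb ε M (−a)` (the bump is even, `(−ε)⁻¹ = −ε⁻¹`). -/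
theorem comb_neg_eps (ε : ℝ) (M : ℕ) (a : ℕ → ℂ) :
    comb (-ε) M a = comb ε M (fun m => -a m) := by
  funext x
  unfold comb
  refine Finset.sum_congr rfl fun m _ => ?_
  have h : ((x - Real.log (m : ℝ)) / -ε) ^ 2 = ((x - Real.log (m : ℝ)) / ε) ^ 2 := by
    rw [div_neg, neg_sq]
  rw [h]
  push_cast
  rw [inv_neg]
  ring

/-- The zero comb gives `Q = 0`. -/
theorem weilQuadratic_comb_eps_zero (M : ℕ) (a : ℕ → ℂ) : weilQuadratic (comb 0 M a) = 0 := by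
  rw [comb_eps_zero, weilQuadratic_zero]

/-- **(L)** The guard `0 < ε` is idle: the unguarded statement is EQUIVALENT to the crux. Consequently no
`crux_false_without_pos` theorem can exist (it would refute the crux, i.e. RH). -/
theorem withoutPos_iff : CombShapePositivityWithoutPos ↔ CombShapePositivity := by
  constructor
  · exact fun h ε _ M => h ε M
  · intro h ε M a
    have h' : ∀ ε : ℝ, 0 < ε → ∀ M : ℕ, CruxAt ε M := crux_iff.mp h
    rcases lt_trichotomy ε 0 with hε | rfl | hε
    · have key : 0 ≤ (weilQuadratic (comb (-ε) M fun m => -a m)).re := h' (-ε) (neg_pos.mpr hε) M _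
      rwa [comb_neg_eps, show (fun m => - -a m) = a from funext fun m => neg_neg (a m)] at key
    · rw [weilQuadratic_comb_eps_zero]; simp
    · exact h' ε hε M a

/-! ## §4b Degenerate corners are TRUE (not refuting), and the unconditional rungs -/

/-- `M = 0`: empty comb. -/
theorem comb_M_zero (ε : ℝ) (a : ℕ → ℂ) : comb ε 0 a = 0 := by
  funext x; simp [comb]

/-- `a = 0` on `[1, M]`: zero comb. -/
theorem comb_coeff_zero (ε : ℝ) (M : ℕ) {a : ℕ → ℂ} (ha : ∀ m ∈ Finset.Icc 1 M, a m = 0) :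
    comb ε M a = 0 := by
  funext x
  exact Finset.sum_eq_zero fun m hm => by rw [ha m hm, zero_mul]

/-- The `M = 0` cells hold. -/
theorem cruxAt_M_zero (ε : ℝ) : CruxAt ε 0 := fun a => by
  rw [comb_M_zero, weilQuadratic_zero]; simp

/-- The `a = 0` instances hold with equality (tightness at zero). -/
theorem weilQuadratic_comb_coeff_zero (ε : ℝ) (M : ℕ) : weilQuadratic (comb ε M 0) = 0 := by
  rw [comb_coeff_zero ε M (a := 0) (fun _ _ => rfl), weilQuadratic_zero]

/-- Support of a comb whose coefficients live on `N ≤ m ≤ N'` (`1 ≤ N`): `⊆ [log N − |ε|, log N' + |ε|]`. -/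
theorem comb_tsupport_subset_of_coeff {ε : ℝ} {M N N' : ℕ} (hN : 1 ≤ N) {a : ℕ → ℂ}
    (ha : ∀ m, a m ≠ 0 → N ≤ m ∧ m ≤ N') :
    tsupport (comb ε M a) ⊆ Icc (Real.log N - |ε|) (Real.log N' + |ε|) := by
  refine closure_minimal (fun x hx => by_contra fun h => hx ?_) isClosed_Icc
  unfold comb
  refine Finset.sum_eq_zero fun m _ => ?_
  by_cases ham : a m = 0
  · rw [ham, zero_mul]
  rcases eq_or_ne ε 0 with rfl | hε
  · simp
  obtain ⟨h1, h2⟩ := ha m ham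
  have hNr : (0 : ℝ) < N := by exact_mod_cast hN
  have hlogN : Real.log N ≤ Real.log m := Real.log_le_log hNr (by exact_mod_cast h1)
  have hlogN' : Real.log m ≤ Real.log N' :=
    Real.log_le_log (by exact_mod_cast (lt_of_lt_of_le hN h1 : 0 < m)) (by exact_mod_cast h2)
  have hfar : |ε| ≤ |x - Real.log m| := by
    simp only [mem_Icc, not_and_or, not_le] at h
    rcases h with h | h
    · calc |ε| ≤ Real.log m - x := by linarith [abs_nonneg ε]
        _ ≤ |x - Real.log m| := by rw [abs_sub_comm]; exact le_abs_self _
    · calc |ε| ≤ x - Real.log m := by linarith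
        _ ≤ |x - Real.log m| := le_abs_self _
  rw [bump_eq_zero hε hfar]
  simp

/-- **(F) UNCONDITIONAL RUNG (short combs at any height).** If the active nodes `N ≤ m ≤ N'` of `a` satisfy
`log N' − log N + 2|ε| ≤ log 2`, the comb instance holds unconditionally: translate by the midpoint
(`weilQuadratic_translate`) into `[−(log 2)/2, (log 2)/2]` and apply Yoshida's theorem
(`weilPositivityOn_of_le_log_two_half`). Covers every cluster of ratio `N'/N ≤ 2e^{−2|ε|}`, in particular all
two-node minors `|w_ε(log q)| ≤ w_ε(0)` with `log q + 2|ε| ≤ log 2`. -/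
theorem crux_inst_short {ε : ℝ} {M N N' : ℕ} (hN : 1 ≤ N) {a : ℕ → ℂ}
    (ha : ∀ m, a m ≠ 0 → N ≤ m ∧ m ≤ N')
    (hlen : Real.log N' - Real.log N + 2 * |ε| ≤ Real.log 2) :
    0 ≤ (weilQuadratic (comb ε M a)).re := by
  set c : ℝ := (Real.log N + Real.log N') / 2 with hc
  set L : ℝ := (Real.log N' - Real.log N) / 2 + |ε| with hL
  have hLle : L ≤ Real.log 2 / 2 := by rw [hL]; linarith
  have hsupp : tsupport (fun t => comb ε M a (t + c)) ⊆ Icc (-L) L := by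
    refine (tsupport_translate_subset (comb_tsupport_subset_of_coeff (M := M) (ε := ε) hN ha) c).trans ?_
    apply Icc_subset_Icc <;> rw [hc, hL] <;> linarith
  have h := weilPositivityOn_of_le_log_two_half hLle _ (isWeilTest_translate (comb_isWeilTest ε M a) c) hsupp
  rwa [weilQuadratic_translate] at h

/-- **(F')** Each cell needs only Weil positivity on ONE cone: `WeilPositivityOn ((log M)/2 + |ε|) → CruxAt ε M`
(translate the comb by `(log M)/2`). So every future extension of Yoshida's unconditional range `a₀ = (log 2)/2`
settles all cells with `log M + 2|ε| ≤ 2a₀`; today that is `M = 1` only (`crux_inst_M_one`): the smallest OPEN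
cells are `M = 2`, any `ε > 0` (the 2×2 minors `|w_ε(log 2)| ≤ w_ε(0)`, numerically tight to 7% as `ε → ∞`, §7). -/
theorem cruxAt_of_weilPositivityOn {ε : ℝ} {M : ℕ} (h : WeilPositivityOn (Real.log M / 2 + |ε|)) :
    CruxAt ε M := by
  intro a
  set c : ℝ := Real.log M / 2 with hc
  have hsupp : tsupport (fun t => comb ε M a (t + c)) ⊆ Icc (-(Real.log M / 2 + |ε|)) (Real.log M / 2 + |ε|) := by
    refine (tsupport_translate_subset (comb_tsupport_subset ε M a) c).trans ?_
    apply Icc_subset_Icc <;> rw [hc] <;> linarith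
  have h' := h _ (isWeilTest_translate (comb_isWeilTest ε M a) c) hsupp
  rwa [weilQuadratic_translate] at h'

/-- Conversely the crux at level `M` is implied by the target cone of half-width `(log M)/2 + ε` — this is the
"rung by rung" reading of kill criterion (iv): cell `(ε, M)` is one `M`-dimensional slice of
`WeilPositivityOn ((log M)/2 + ε)`. -/
theorem crux_of_forall_cells (h : ∀ ε : ℝ, 0 < ε → ∀ M : ℕ, WeilPositivityOn (Real.log M / 2 + |ε|)) :
    CombShapePositivity := fun ε hε M => cruxAt_of_weilPositivityOn (h ε hε M)

/-- **(F) M = 1 rung**: `0 < |ε| ≤ (log 2)/2`… in fact any `ε` with `2|ε| ≤ log 2` (incl. `ε = 0`). -/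
theorem crux_inst_M_one {ε : ℝ} (hε : 2 * |ε| ≤ Real.log 2) : CruxAt ε 1 := by
  intro a
  have hsub : ∀ m, (fun m => if m = 1 then a m else 0) m ≠ 0 → 1 ≤ m ∧ m ≤ 1 := by
    intro m hm
    by_cases h1 : m = 1
    · subst h1; simp
    · simp [h1] at hm
  have key := crux_inst_short (ε := ε) (M := 1) le_rfl hsub (by simpa using hε)
  have e : comb ε 1 (fun m => if m = 1 then a m else 0) = comb ε 1 a := by
    funext x; simp [comb]
  rwa [e] at key

/-! ## §5 Monotonicity in the level `M` -/

/-- Extending the coefficients by zero: the level-`M` comb is a level-`M'` comb for `M ≤ M'`. -/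
theorem comb_extend {ε : ℝ} {M M' : ℕ} (hMM' : M ≤ M') (a : ℕ → ℂ) :
    comb ε M' (fun m => if m ≤ M then a m else 0) = comb ε M a := by
  funext x
  unfold comb
  rw [← Finset.sum_subset (Finset.Icc_subset_Icc_right hMM')]
  · refine Finset.sum_congr rfl fun m hm => ?_
    rw [Finset.mem_Icc] at hm
    simp [hm.2]
  · intro m hm hm'
    rw [Finset.mem_Icc] at hm hm'
    have : ¬ m ≤ M := fun h => hm' ⟨hm.1, h⟩
    simp [this]

/-- **(M)** `CruxAt ε M' → CruxAt ε M` for `M ≤ M'` (principal submatrix). Hence the crux is equivalent to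
its restriction to any cofinal set of levels `M`. -/
theorem cruxAt_mono {ε : ℝ} {M M' : ℕ} (hMM' : M ≤ M') (h : CruxAt ε M') : CruxAt ε M := by
  intro a
  have := h (fun m => if m ≤ M then a m else 0)
  rwa [comb_extend hMM'] at this

/-- The crux restricted to levels `M ≥ M₀` is still the whole crux. -/
theorem crux_iff_eventually (M₀ : ℕ) :
    CombShapePositivity ↔ ∀ ε : ℝ, 0 < ε → ∀ M : ℕ, M₀ ≤ M → CruxAt ε M :=
  ⟨fun h ε hε M _ => h ε hε M, fun h ε hε M =>
    cruxAt_mono (le_max_right M₀ M) (h ε hε (max M₀ M) (le_max_left _ _))⟩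

/-! ## §6 Natural strengthenings -/

/-- **(S1)** The STRICT form of the crux is false (tight at `a = 0`; also at `M = 0`). Under RH strictness
holds for `a ≢ 0` on `[1, M]` (a nonzero Dirichlet polynomial times `φ̂_ε` cannot vanish at every zero of ζ),
so the only slack-free instances are the trivial ones — but the numerical margin is tiny, see §7. -/
theorem not_crux_strict :
    ¬ ∀ ε : ℝ, 0 < ε → ∀ (M : ℕ) (a : ℕ → ℂ), 0 < (weilQuadratic (comb ε M a)).re := by
  intro h
  have := h 1 one_pos 1 0
  rw [weilQuadratic_comb_coeff_zero] at this
  exact lt_irrefl _ this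


/-! ## §7 Numerics (N) — exact comb Gram matrices in the tree normalisation

Source: `local/comb_local.py` (pure python, this seat, 2026-08-16) and kit job j007991 (numpy twin `job/main.py`,
smoke run, exit 0): VALIDATION — the arithmetic kernel (polar − prime + Bombieri arch) agrees with the zero side
2Σ_{γ>0} φ̂₀(εγ)² cos(γx) (60 zeros, mpmath) to 1e-13 at ε = 1 (x = 0, 0.013, 0.3, log 2, 1, 2.5; near- and
far-diagonal routines) and to the 60-zero tail 3e-6 at ε = 0.2; near/far routines agree to 1e-15 at the switch,
quadrature refinement changes nothing above 2e-15; w_1(0) = 1.254269736e-4 (= earlier seats' value); the whole small-M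
matrices agree with the zero-side Gram matrices entrywise (|K − K_Z|_max = 1e-13 at ε = 1). Kit jobs j007995 (M ≤ 800,
εM ≤ 20, 300 zeros) and j008240 (fragility to M = 800) extend the tables below and self-attach to the item.
Notation: `K = K_{ε,M} = [w_ε(log(m/m'))]_{m,m'≤M} = P − Pr + A` (polar, prime, archimedean parts),
`w_ε(x) = 2cosh(x/2)F_ε² − Σ_n Λ(n)n^{−1/2}[ψ_ε(log n − x) + ψ_ε(log n + x)] − (log 4π + γ)ψ_ε(x) − I(x)`,
`ψ_ε = φ_ε ⋆ φ_ε`, `‖φ_ε‖₂² = ψ_ε(0) = 0.1330861/ε`, margins in units of `‖φ_ε‖₂²` (per unit `‖a‖²`).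

(N1) MARGIN LAW. `λ_min(K)/‖φ_ε‖²` is a function of `εM` to ±15 %, slowly INCREASING in `M`:
  εM    : 0.05   0.2    0.5     1       2       5       10      20
  M=60  : 1.645  0.498  0.0533  8.30e-3 5.40e-4 6.33e-6 6.60e-8 1.95e-10
  M=120 :               0.0545  8.48e-3 5.64e-4 7.33e-6 8.25e-8
  M=200 :               0.0550  8.54e-3 5.71e-4 7.98e-6
  (M=30: 7.9e-3, 4.8e-4, 5.2e-6, 4.9e-8 at εM = 1, 2, 5, 10.)  ln(margin) ≈ −4.8 − 5.3(√(εM) − 1) for εM ≥ 1.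
  All 30+ matrices computed (M ≤ 120, εM ≤ 20; earlier seats: M ≤ 150, εM ≤ 5) are positive definite — as they
  must be: by `crux_of_riemannHypothesis` a negative eigenvalue at accessible (ε, M) would contradict RH where it is
  VERIFIED (zeros enter cell (ε, M) with weight |φ̂₀(εγ)|² ≈ e^{−2√(εγ)}; height 3·10¹² is invisible for ε ≳ 10⁻⁹).
  CONSEQUENCE: a proof valid at the transition must be loss-free at relative precision margin/diag ≈ 3·10⁻³ (εM = 1,
  diag = log(1/ε) − 1.93) and ≈ 10⁻⁵ at εM = 5: no estimate with an O(1)·‖φ_ε‖²‖a‖² loss survives εM ≳ 0.3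
  (NewmanConjecture "no margin", quantified for combs).
(N2) EXTREMAL VECTOR. The bottom eigenvector is entrywise of one sign and Perron-like for every cell computed:
  overlap with m^{−1/2}/√H_M = 0.9996 (εM = 0.05) … 0.988 (εM = 5) … 0.979 (εM = 20); BUT the Rayleigh quotient of
  the exact Perron ray overestimates λ_min by orders of magnitude beyond the transition (εM = 1: 1.8e-2 vs 8.4e-3;
  εM = 5: 3.1e-2 vs 7.1e-6): the whole margin sits in the 1–2 % correction to m^{−1/2}. "Classify extremal vectors
  = m^{−1/2} profiles" is right to leading order and useless at the precision required.
(N3) WHICH TERMS ARE LOAD-BEARING (M = 100; λ_min/‖φ_ε‖² of the matrix with a part removed; and the Rayleigh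
  decomposition polar / −prime / arch-diag / arch-offdiag at the true bottom eigenvector):
  εM=0.05: full +1.652 | no-polar +1.499 | arch-diag-only +1.723 | no-prime +5.456 | 0.15/−4.07/+5.65/−0.07
  εM=0.5 : full +0.0542| no-polar −1.644 | arch-diag-only +0.438 | no-prime +1.400 | 1.47/−4.07/+3.34/−0.69
  εM=1   : full +8.4e-3| no-polar −3.744 | arch-diag-only −0.097 | no-prime −0.652 | 2.77/−4.12/+2.65/−1.28
  εM=2   : full +5.6e-4| no-polar −7.662 | arch-diag-only −0.426 | no-prime −2.342 | 5.44/−5.18/+1.95/−2.21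
  εM=5   : full +7.1e-6| no-polar −19.27 | arch-diag-only −2.565 | no-prime −7.421 | 12.6/−9.43/+1.02/−4.23
  M = 200 reproduces every entry to ±5 % (e.g. εM=1: full +8.5e-3 | no-polar −3.86 | arch-diag-only −0.060 |
  no-prime −0.627; εM=5: −19.96 / −3.16 / −7.87): the load-bearing map is a function of εM, not of M.
  So: the POLE is load-bearing from εM ≈ 0.3 on (with its favourable sign on the Perron ray); from εM ≈ 1 on the
  archimedean OFF-diagonal (the −B_M-type part) is load-bearing too, AND `P + A` ALONE IS INDEFINITE: there are
  directions on which only the prime sum makes W ≥ 0. At the transition none of polar / −prime / arch can be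
  dropped or bounded one-sidedly; positivity is the explicit-formula identity, not an inequality between its parts.
  Gershgorin row margins are ≤ −6 (up to −25) in EVERY cell incl. εM = 0.05: diagonal dominance never holds.
(N4) ARITHMETIC FRAGILITY (Beurling test, M = 100): replace Λ by Λ + (log q)·1_{n=q} at ONE composite q ("fake
  prime"), or delete ONE prime p with its powers; λ_min/‖φ_ε‖² of the modified matrix:
  εM=0.05: no q flips (min +1.13 at q=6); deleting p = 2/3/7/31 RAISES λ_min by +0.49/+0.36/+0.18/+0.04.
  εM=0.2 : only q = 6 flips (−0.036); deletions still raise (+0.38 … +0.03).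
  εM=0.5 : every composite q ≤ 45 flips (q=6: −0.53 … q=45: −0.032), q ≥ 52 does not; deletions still raise (+0.09).
  εM=1   : EVERY composite tested (6 ≤ q ≤ 78) flips (q=6: −0.68 … q=78: −0.060; the effect dies only as
           q → M·e^{2ε}); deleting p = 2/3/7/31 now FLIPS too
           (−0.31/−0.28/−0.14/−0.017).
  εM=2   : every q flips (−0.84 … −0.19 at q=91); deletions −0.76 … −0.24.   εM=5: (−1.7 … −0.54; −2.0 … −0.86).
  Larger M: εM=0.5 — M=200: composites q ≤ 54 flip, q ≥ 75 do not (threshold q* ≈ 50–75, M-independent between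
  M = 100 and 200), deletions raise λ_min; εM=1 — M=150: all q ≤ 112 flip; M=200: all q ≤ 172 flip (−0.72 at q=6 …
  −0.019 at q=172), deleting 2/3/7 flips (−0.31/−0.27/−0.12), deleting 31 costs 0.0075–0.0088 ≈ the whole margin
  (λ_min → +1.0e-3 at M=150, −2.3e-4 at M=200). First-order perturbation theory at the bottom eigenvector predicts
  every flip (the exact change is about twice the first-order one). Measured response (M = 200, εM = 1):
  δλ_min ≈ −κ·(log q/q)·h·‖φ_ε‖² with h := H_{M/q}/H_M (overlap of the Perron ray with its q-dilate) and κ ≈ 4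
  (κh = 2.4, 2.1, 1.3, 0.8, 0.9 at q = 6, 15, 55, 105, 172). THRESHOLD LAW: q flips the sign iff κ(log q/q)h ≳ f(εM).
  At M ≤ 200 this is every composite in range for εM ≥ 1 and q ≲ 50–75 for εM = 0.5 (measured); as M → ∞,
  h → 1 − log q/log M and the saturated thresholds are q* ≈ 4·10² (εM = 0.5), 4·10³ (1), 10⁵ (2), 10⁷ (5), 10⁹ (10)
  — extrapolations from κ ≈ 4; kit j008240 brackets q* at M = 800.
  READING. (a) For εM ≳ 1 the cell (ε, M) is FALSE for every single-site modification of Λ at any q ≲ q*(εM) in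
  range, in both directions (the prime term switches from "enemy" to load-bearing between εM = 0.5 and 1, matching
  (N3)); hypotheses on Λ that survive such a change — Λ ≥ 0, support on the prime powers of SOME integer sequence,
  Chebyshev / Brun–Titchmarsh / large-sieve / mean-value bounds — cannot imply such a cell; only identities
  (Σ_{d|n}Λ(d) = log n for all n ≤ M, the Euler product / explicit formula) or prime-sum ASYMPTOTICS WITH CONSTANTS
  at precision ≈ f(εM)/κ distinguish Λ from its modifications. (b) PRECISION LADDER: a proof of the window εM ≤ C
  must carry Mertens/Chebyshev-type prime sums (against the smooth weights ψ_ε at lags log n, Perron-weighted) to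
  absolute precision ≈ f(C)/κ uniformly in the range: 1.4·10⁻² (C = 0.5), 2·10⁻³ (C = 1), 1.4·10⁻⁴ (C = 2), 2·10⁻⁶
  (C = 5), 2·10⁻⁸ (C = 10), 5·10⁻¹¹ (C = 20). Explicit prime-number-theorem technology plus exact computation below a
  fixed height delivers roughly 10⁻³, so the BOUNDED window C = 1 is plausibly unconditional (all three
  explicit-formula terms kept exactly, (N3)), C = 2 is borderline, and the RH content of the crux is the limit C → ∞,
  where the required precision decays like f(C) — faster than any known zero-free region provides. This is
  consistent with the route text ("the two-node detection uses ε·M unbounded; it says nothing about bounded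
  windows"). The subcritical regime (CombSubcritical) is the robust end of the same ladder.
(N1') LARGE-ε / SMALL-M LAW (zero-killer regime; j007991 T3, arithmetic = zero side to ≥ 5 digits): with M nodes
  the bottom eigenvector annihilates the first ≈ M/2 zeros, and λ_min is set by the weight of the next one:
  λ_min(K_{ε,M}) ≈ 10⁻²·2φ̂₀(εγ_{⌈M/2⌉})² within 1–2 orders over 6 decades — e.g. ε = 1: M = 2/3/4/6/10/16 →
  λ_min = 1.8e-5/3.3e-6/1.1e-6/6.2e-8/5.6e-9/1.3e-10 against 2φ̂₀(γ_J)² = 1.1e-4/9.8e-6/9.8e-6/4.1e-6/2.6e-7/2.2e-8;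
  ε = 3, M = 16: λ_min = 0 to double precision (±2e-15 vs diag 9e-8; 2φ̂₀(3γ₈)² = 1.5e-13). So at fixed M the margin
  dies like e^{−2√(εγ_{M/2})} in ε, while along the transition εM = c one has εγ_{M/2} ≈ cπ/log M ↓, consistent with
  the mild GROWTH of f(εM) in M in (N1): the zero-killer mechanism does not by itself force the transition margin to 0
  as M → ∞ (the M ≤ 800 scan j007995 is the pending check).
(N5) KERNEL PROFILE / TWO-NODE MINORS. w_ε is not a nonnegative function: w_ε(x) < 0 already inside the bump
  core (first zero at x = 1.2ε for ε = 0.01, 0.74ε for ε = 0.1; the arch off-diagonal ≈ −(∫φ₀)²/(2x) wins), and for x ≥ log 2 between 1/3 and 1/2 of all x have w_ε(x) < 0 (prime spikes at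
  x = log p^k plus the cos(γ₁x) oscillation). sup_{x ≥ log 2}|w_ε(x)|/w_ε(0) = 0.260 (ε = 0.01, at x = log 7),
  0.844 (ε = 0.1), 0.988 (ε = 1, x = 8π/γ₁): entrywise-positivity / Schur-product arguments are unavailable, and the
  real-node two-point minors are tight to 1.2 % at ε = 1; over RATIONAL nodes p/q ≤ 60 the largest minor ratio is
  0.260 at 7/1 (ε = 0.01) and 0.938 at 60/59 (ε = 0.3, a near-diagonal lag). Large ε is governed by the lowest zeros:
  w_ε(log 2)/w_ε(0) = −0.804, −0.848, −0.857, −0.900 at ε = 1/4, 1/2, 1, 2 → cos(γ₁ log 2) = −0.934 (ε → ∞); the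
  smallest open cells M = 2 (any ε > 0) have margin 1 − |w_ε(log 2)|/w_ε(0) → 6.6 %; M = 6, ε = 2: λ_min/diag = 1.4e-4.
-/

/-! ## §7b Numerics on lacunary sub-combs (N6) — calibration for the tower / S-unit / Bohr–Fejér ideas

`local/tower.py` (same validated kernel; absolute noise floor ≈ 10⁻¹¹ at lags x ≳ 10 from the polar/prime
cancellation, so values below it are not reported). Margins in units of the diagonal c₀ = w_ε(0).
* GEOMETRIC TOWER b = 2 (nodes 2^j, j ≤ J; Toeplitz T_J = [w_ε((j−k) log 2)]): λ_min(T_14)/c₀ = 0.395 (ε = 0.003),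
  0.199 (0.01), 0.078 (0.03), 9.3e-3 (0.1), 1.2e-3 (0.3), 2.2e-5 (ε = 1, a plateau from J ≈ 9 on); the decay in J is
  slow (ε = 0.01: 0.82, 0.68, 0.57, 0.49, … 0.20 for J = 1 … 14) although the dense comb at the same (ε, M = 2^J =
  16384, εM = 164) has margin ~10⁻²⁹ by (N1): a 15-node principal submatrix is exponentially better conditioned. First
  lag: c₁/c₀ = w_ε(log 2)/w_ε(0) = −0.13, −0.18, −0.27, −0.52, −0.59, −0.86 (ε = 0.003 … 1) — the prime 2 itself; b = 3:
  −0.16 … −0.93; T_J is nowhere near diagonally dominant for ε ≥ 0.1, and Levinson/Schur reflection coefficients start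
  at |α₁| = |c₁|/c₀ ≥ 0.5 there.
* TWO-PRIME LADDER (nodes 2^i3^j ≤ M; 40 / 67 / 142 nodes for M = 10³ / 10⁴ / 10⁶): λ_min/c₀ = 7.4e-2 / 3.2e-2 /
  3.6e-3 (ε = 0.01); 2.2e-4 / 2.3e-5 / 1.0e-6 (ε = 0.1); 2.0e-5 / 1.1e-6 / (≈5e-9, at the floor) (ε = 0.3); 3.0e-8 /
  (floor) / (floor) (ε = 1). At fixed ε the decay in M is POLYNOMIAL, λ_min ≈ c₀·M^{−α(ε)} with α ≈ 0.4 (ε = 0.01),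
  0.8 (0.1), 1.2 (0.3) — versus e^{−5.3√(εM)} for dense combs: on S-unit ladders "barely positive" means power-small,
  which is the quantitative content of the s-unit card's "frontier M = ε^{−A} is a quasi-RH" and of the tower card's
  conditioning claim; all computed lacunary matrices above the floor are positive definite (as RH demands).
-/

/-! ## §8 Barriers and literature (B)

* No catalogued barrier refutes the STATEMENT (it is RH-implied, §2); `ledger negatives --problem RiemannHypothesis`
  = 0 (2026-08-16). Technique-level:
* `Literature.Barriers.RiemannHypothesis.BeurlingCounterexamples` (Diamond–Montgomery–Vorhauer 2006; Broucke 2025):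
  arguments using of ℤ only multiplicativity + N(x) = κx + O(x^θ) relativise to Beurling systems where RH fails.
  (N4) is the comb-level, quantitative form: beyond εM ≈ 1 the crux fails for every one-site modification of Λ.
* Zero-side analogue: route `WeilAdversary`, crux `CountingNoGo` (stmt-RiemannHypothesis-1164, open): with only
  "RH verified to T₀ + Riemann–von Mangoldt band", Weil positivity on [−2/5, 2/5] is expected NOT certifiable; by
  `cruxAt_of_weilPositivityOn` every cell with (log M)/2 + ε > (log 2)/2, i.e. all M ≥ 2, lies beyond the printed
  unconditional cone, and all M ≥ 3 beyond the adversarial one.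
* `NewmanConjecture` (no margin): consistent and quantified by (N1). `DeBrangesPositivity` (Conrey–Li): a different,
  stronger positivity; not engaged. `MollifierLimitations`: not in class.
* Literature (searchd rc 75, OpenAlex/arXiv 429 this cycle; Semantic Scholar answered). Nearest finite-matrix
  Weil-positivity instruments in print: Connes–van Suijlekom arXiv:2511.23257 and Connes–Consani–Moscovici
  arXiv:2511.22755 (Galerkin truncations: prime cutoff c, frequency band N), Groskin arXiv:2607.02828 (Thm 2.5: every
  value of the truncated form is an exact sum over the zeros — the analogue of the comb Gram identity
  W = Σ_ρ|ĝ(ρ)|² under RH; deep spectrum of scale 10⁻⁵⁹ at c = 100 — the analogue of (N1); and a finite-cutoff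
  archimedean truncation that produced SPURIOUS deep negative eigenvalues, corrected by the cutoff-free form — the
  analogue of the card's "−0.8 at εM = 1" model artefact; reading rule Cor. 3.3: a negative eigenvalue inside the
  quadrature/tail budget certifies nothing), Silva 2026 (zenodo 20682834: "the pole term is the only obstruction to
  Perron structure in the localized Weil quadratic form" — cf. (N2)/(N3)), Suzuki arXiv:2606.09096 (screw function).
  None works in the Dirichlet-coefficient (log-integer comb) basis or states a discrete-node PSD criterion; none
  contains a negative result bearing on the crux — structurally impossible anyway (a printed counterexample would be
  a disproof of RH, §2).
-/


/-! ## §10 The filed crux ideas against these findings (information for the triage panel — no grades)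

Six ideas are filed in `Cruxes/CombShapePositivity/Ideas/` (2026-08-16). Where the findings above bear:
* tapered-perron-localisation — consistent with (N1)–(N3) (its M = 800 numerics j009515 agree with the margin law:
  8.6e-3 / 5.8e-4 at εM = 1 / 2; bottom = tapered Perron ray, cf. (N2)); its aliasing law λ_min ≍ |φ̂₀(2πεM)|² is the
  large-M arithmetic refinement of (N1') (ζ_M kills all zeros below the approximate-functional-equation edge 2πM, not
  just M/2 of them). TENSION to resolve in triage: its "unconditional window theorem from Mertens-type prime averages
  with classical error terms" must meet the precision ladder (N4b): at C = 1 the prime averages are needed to ≈ 2·10⁻³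
  absolute, uniformly in M — classical O(1/log M) remainders reach that only for log M ≳ 500, so the line needs either
  an identity-level cancellation of the 1/log M terms on the soft cone, or explicit-PNT input of Ramaré type
  (Σ_{n≤x}Λ(n)/n = log x − γ + O*(10⁻²/log x), itself resting on verified zeros + zero-free regions), or certified
  computation up to the height where the remainder drops below 2·10⁻³.
* frobenius-tower-toeplitz, s-unit-comb-toeplitz-ladder, bohr-fejer-reduction — lacunary restrictions; (N6) gives
  their conditioning: geometric towers keep O(10⁻¹…10⁻⁵) margins out to J = 14, two-prime ladders decay polynomially
  in M; both are exponentially better posed than dense cells of the same size, and both push the RH content to the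
  limit (J → ∞ / M → ∞ at fixed ε), where (N1')-type zero-killing sets the margin. The first lags c₁/c₀ ∈ [−0.93, −0.13]
  (N6) are the "one-prime kicks" of levinson-through-primes at the coarsest scale.
* pole-shadow-pair-sign — works on the mollified-Perron subfamily; (N2)/(N3) confirm that the pole is load-bearing
  with favourable sign exactly there, and (N4) warns that on that subfamily the sign still responds to single primes
  q ≲ q*(εM) with O(1) coefficients (κh ≈ 2.4 at q = 6).
* levinson-through-primes — lag-axis continuation; (N5) (kernel sign pattern, sup|w|/w₀) and (N6) (reflection
  coefficients |α₁| ≥ 0.5 for ε ≥ 0.1) are its base data; the noise floor 10⁻¹¹ at lags ≳ 10 (polar/prime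
  cancellation = PNT in short windows) is the practical limit of any double-precision continuation.
-/

/-! ## §9 For the planner / lead (reading of the findings against the route's kill criteria)

* Kill (i)/(ii) cannot fire numerically at accessible (ε, M) (§2 + visibility of zeros), as all earlier seats said;
  the numbers here are calibration, not a search.
* Kill (iv) ("is the comb cell verbatim a cone rung with no matrix-side gain?"): formally, cell (ε, M) ⇐
  `WeilPositivityOn ((log M)/2 + ε)` (`cruxAt_of_weilPositivityOn`) and uses the primes n ≤ M·e^{2ε} = e^{2a},
  exactly the prime range of that cone rung — same arithmetic content, a finite-dimensional SECTION of the rung (the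
  converse needs Detection, M → ∞). (N4) says the section at the transition still needs every one of those primes
  exactly; (N3) says it needs all three explicit-formula terms with their signs. So a "matrix-side gain" can only be
  an IDENTITY-LEVEL finite-dimensional bookkeeping of the explicit formula (divisor-graph / Helson algebra for the
  prime side, as in line helson-dirichlet-slack of CombSubcritical, COUPLED to the archimedean kernel at lags
  |log(m/m')| ≲ ε and to the rank-2 pole), never an estimate: the subcritical regime εM ≤ 0.2 is the only one where
  one-sided bounds have room ((N1): margin ≥ 0.5‖φ_ε‖²; (N4): robust to single primes).
* Suggested decomposition for the two-layer plan: CombShapeSubcritical should stop at εM ≈ 0.2–0.3 (last regime where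
  dropping the pole keeps λ_min > 0 is εM < 0.3 by (N3); fragility sets in at εM ≈ 0.2–0.5 by (N4)); a BOUNDED-WINDOW
  item "CombShapeWindow C" (c₀ ≤ εM ≤ C, all M) is by the precision ladder (N4b) plausibly unconditional for C = 1
  (arithmetic precision ≈ 2·10⁻³, all three explicit-formula terms kept exactly) and is where a matrix-side gain could
  be real; "CombShapeTransition" = all εM ≥ c₀ is RH-hard precisely through C → ∞ (precision f(C)/κ → 0 like
  e^{−5.3√C}).
* Smallest open cells worth a prover's week (unconditional, NOT RH-hard individually): M = 2, all ε > 0 — the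
  inequality |w_ε(log 2)| ≤ w_ε(0) for one explicit function of ε (margin ≥ 6.6 %, decided by γ₁ for ε ≳ 1 and by
  diagonal dominance for ε ≲ 0.05; needs interval numerics in between plus an effective explicit formula with the
  lowest zeros). Its value is calibration of the toolchain, not progress on RH.
-/

end Summit.RiemannHypothesis.RiemannHypothesis.Cruxes.CombShapePositivity.Disproof

end
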